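import Summits.NavierStokesRegularity.NavierStokesRegularity.Theorems.ScenarioCensusAffineMeter
import Summits.NavierStokesRegularity.NavierStokesRegularity.Theorems.ScenarioCensusBlochMeter
import HarnessLib

/-!
# AFFINE METER port, part 2/4: §B⁺ rank-two hyperbolic twins (LOXODROMIC type): the laws in operator form; §C controls (hypotheses are load-bearing; the open cell is kinematically nonempty)

Re-homed for the scenario census (typer seat ns-census-typer-1 g10; the cells A2afH / A2afP / A2afI / A2afL (velocity twins) and A2avH / A2avP / A2avI / A2avL (vorticity twins, REV 2) are
MEMBERS OF RECORD «DECIDED IN KERNEL IN FILES» of row A2 (ns-idea-2 g18 LINE g18-3 REV 2: critic idea-crit-3 PASS (REV 1 14:53:06Z, REV 2 stamp), ref ns-census-ref g16 PRE-CHECK ✓ §21.11,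
lead label; OF RECORD 4/4 at census v1.132), A2afPd / A2afI0 / A2afE OPEN (typed); this port makes the decided cells TREE-decided): VERBATIM PORT of ns-idea-2 LINE g18-3 «affine-meter»
REV 2, `pub/ideators/ns-idea-2/lines/affine-meter/line-affine-meter.rev2.lean` sha16 021917a0ebe35407 (1145 l., lean check rc 0, 0 sorry), split for the 400-line rule into
`ScenarioCensusAffineMeter` (§0, §A, §B) → `…AffineMeterLoxodromic` (§B⁺, §C) → `…AffineMeterRows` (§G, §V) → `…AffineMeterRealisability` (§R + census KEYS).  Lean text VERBATIM in
namespace `…Theorems.ScenarioCensus.AffineMeter` (the line's `…Lines.AffineMeter` re-homed); port edits: the line's `local notation "E3"` is spelled as the reducible `abbrev E3` of every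
census file; `norm_slice_le` / `eq_zero_of_slice_translate` / `divergence_conj` are the landed BLOCH METER's (`BlochMeter.norm_slice_le` / `eq_zero_of_slice_periodic` / `divergence_conj`, BY NAME, gate lint dedup.landed — the two g18 lines share these helpers verbatim); `hasFDerivAt_coord` (twin of a Literature lemma outside this closure) is not re-declared — its three instances are stated inline; the two explicit-name `open … (…)` lines of §V spell the opened namespaces in full (inside `…Theorems.ScenarioCensus.*` the relative spelling resolves twice and makes the aliases ambiguous); `@[conjecture]` on the OPEN rows `Row_A2afPd`,
`Row_A2afI0`, `Row_A2afE`; one-line docstrings added where missing (gate lint).  Statements untouched.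

No census VALUE is moved here (row A2 stays OPEN-WITH-LINE; the members become TREE-decided by name); (L′) is NOT proved; no summit statement is proved by this file. Lemmas that restate already-landed tree declarations are taken BY NAME (gate lint `dedup.landed`): `norm_slice_le` = `BlochMeter.norm_slice_le`, `eq_zero_of_slice_translate` = `BlochMeter.eq_zero_of_slice_periodic`, `divergence_conj` = `BlochMeter.divergence_conj`.
-/

-- the summit and its single problem share the name `NavierStokesRegularity` (D-0017 nested layout)
set_option linter.dupNamespace false

noncomputable section

open Set Function Filter Metric MeasureTheory InnerProductSpace
open scoped Topology RealInnerProductSpace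
open Literature.Analysis Literature.Analysis.FluidPDE
open Summit.NavierStokesRegularity.NavierStokesRegularity.Theorems
open Summit.NavierStokesRegularity.NavierStokesRegularity.Theorems.ScenarioCensus

namespace Summit.NavierStokesRegularity.NavierStokesRegularity.Theorems.ScenarioCensus.AffineMeter

/-! ### §B⁺  Rank-two hyperbolic twins (LOXODROMIC type): the laws in operator form

The same two laws decide every affine twin `f(M x + b) = M f(x)` whose linear part is a ROTATION (or any
isometry `R` fixing a unit vector `e`) COMPOSED WITH A STRETCH `μ` ALONG `e`, `|μ| ≠ 1`:
`M v = R v + (μ − 1)⟪e, v⟫ e` — a spiral sink/source similarity of the slice.  LAW 1 in covector form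
(`⟪e, M v⟫ = μ ⟪e, v⟫`), LAW 2 in operator form (`M` is isometric on the invariant plane `e^⊥` where the values
of `f` live once the heights are dead, and `e` is a stable eigenvector of `M` or of `M⁻¹`).  Incompressibility
is not used. -/

/-- LAW 1, covector form: a bounded twin `f(Mx + b) = M f(x)` and a covector `n` with `⟪n, M v⟫ = μ⟪n, v⟫`,
`|μ| > 1`, force `⟪n, f⟫ ≡ 0`. -/
theorem covector_eq_zero_of_twin {f : E3 → E3} {M : E3 →L[ℝ] E3} {b n : E3} {μ K : ℝ}
    (hK : ∀ x, ‖f x‖ ≤ K) (h : ∀ x, f (M x + b) = M (f x)) (hn : ∀ v, ⟪n, M v⟫ = μ * ⟪n, v⟫)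
    (hμ : 1 < |μ|) (x : E3) : ⟪n, f x⟫ = 0 := by
  have hit : ∀ (k : ℕ) (x : E3), ⟪n, f ((fun x => M x + b)^[k] x)⟫ = μ ^ k * ⟪n, f x⟫ := by
    intro k
    induction k with
    | zero => intro x; simp
    | succ k ih => intro x; rw [Function.iterate_succ_apply, ih, h, hn, pow_succ]; ring
  by_contra hne
  have hpos : 0 < |⟪n, f x⟫| := abs_pos.2 hne
  have hbd : ∀ k : ℕ, |μ| ^ k * |⟪n, f x⟫| ≤ ‖n‖ * K := fun k => by
    have h2 : |⟪n, f ((fun x => M x + b)^[k] x)⟫| ≤ ‖n‖ * ‖f ((fun x => M x + b)^[k] x)‖ :=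
      abs_real_inner_le_norm _ _
    rw [hit k x, abs_mul, abs_pow] at h2
    exact h2.trans (mul_le_mul_of_nonneg_left (hK _) (norm_nonneg _))
  have ht := (tendsto_pow_atTop_atTop_of_one_lt hμ).atTop_mul_const hpos
  obtain ⟨k, hk⟩ := (ht.eventually_gt_atTop (‖n‖ * K)).exists
  exact absurd (hbd k) (not_le.2 hk)

/-- The inverse twin, operator form. -/
theorem twin_inv_clm {f : E3 → E3} {M M' : E3 →L[ℝ] E3} {b : E3} (hMM' : ∀ v, M (M' v) = v)
    (hM'M : ∀ v, M' (M v) = v) (h : ∀ x, f (M x + b) = M (f x)) (y : E3) :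
    f (M' y + -(M' b)) = M' (f y) := by
  have hy : M (M' y + -(M' b)) + b = y := by rw [map_add, map_neg, hMM', hMM']; abel
  have h1 := h (M' y + -(M' b))
  rw [hy] at h1
  rw [h1, hM'M]

/-- POCKET ⇒ GLOBAL, operator form. -/
theorem twin_of_pocket_clm {f : E3 → E3} (hf : AnalyticOnNhd ℝ f univ) {M : E3 →L[ℝ] E3} {b : E3}
    {U : Set E3} (hU : IsOpen U) (hne : U.Nonempty) (h : ∀ x ∈ U, f (M x + b) = M (f x)) (x : E3) :
    f (M x + b) = M (f x) := by
  obtain ⟨z₀, hz₀⟩ := hne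
  have h1 : AnalyticOnNhd ℝ (fun x => f (M x + b)) univ := fun x _ =>
    (hf _ (mem_univ _)).comp ((M.analyticAt x).add analyticAt_const)
  have h2 : AnalyticOnNhd ℝ (fun x => M (f x)) univ := fun x _ => (M.analyticAt _).comp (hf x (mem_univ _))
  exact h1.eqOn_of_preconnected_of_eventuallyEq h2 isPreconnected_univ (mem_univ z₀)
    (Filter.eventuallyEq_of_mem (hU.mem_nhds hz₀) fun y hy => h y hy) (mem_univ x)

/-- LAW 2, operator form (contraction): if the differences of values of a Lipschitz twin satisfy a property
`P` that `M` preserves ISOMETRICALLY, and `w` is an eigenvector of `M` with `|μ| < 1`, then `f` is invariant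
under all translations along `w` (`‖d‖ = ‖Mᵏ d‖ = ‖f(gᵏ(x + τw)) − f(gᵏx)‖ ≤ L|τ||μ|ᵏ‖w‖ → 0`). -/
theorem translate_eq_of_twin_contracting {f : E3 → E3} {M : E3 →L[ℝ] E3} {b w : E3} {μ L : ℝ}
    {P : E3 → Prop} (hP : ∀ v, P v → P (M v) ∧ ‖M v‖ = ‖v‖) (hfP : ∀ x y, P (f x - f y))
    (hL : ∀ x y, ‖f x - f y‖ ≤ L * ‖x - y‖) (h : ∀ x, f (M x + b) = M (f x)) (hw : M w = μ • w)
    (hμ : |μ| < 1) (x : E3) (τ : ℝ) : f (x + τ • w) = f x := by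
  have hit : ∀ (k : ℕ) (x : E3), f ((fun x => M x + b)^[k] x) = (⇑M)^[k] (f x) := by
    intro k
    induction k with
    | zero => intro x; rfl
    | succ k ih => intro x; rw [Function.iterate_succ_apply, Function.iterate_succ_apply, ih, h]
  have horb : ∀ (k : ℕ) (x : E3),
      (fun x => M x + b)^[k] (x + τ • w) = (fun x => M x + b)^[k] x + (τ * μ ^ k) • w := by
    intro k
    induction k with
    | zero => intro x; simp
    | succ k ih =>
      intro x
      rw [Function.iterate_succ_apply', Function.iterate_succ_apply', ih]
      simp only [map_add, map_smul, hw, smul_smul, pow_succ]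
      module
  have hiso : ∀ (k : ℕ) (v : E3), P v → P ((⇑M)^[k] v) ∧ ‖(⇑M)^[k] v‖ = ‖v‖ := by
    intro k
    induction k with
    | zero => intro v hv; exact ⟨hv, rfl⟩
    | succ k ih =>
      intro v hv
      rw [Function.iterate_succ_apply']
      exact ⟨(hP _ (ih v hv).1).1, ((hP _ (ih v hv).1).2).trans (ih v hv).2⟩
  have hsub : ∀ (k : ℕ) (a c : E3), (⇑M)^[k] (a - c) = (⇑M)^[k] a - (⇑M)^[k] c := by
    intro k
    induction k with
    | zero => intro a c; rfl
    | succ k ih =>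
      intro a c
      rw [Function.iterate_succ_apply', Function.iterate_succ_apply', Function.iterate_succ_apply', ih,
        map_sub]
  have key : ∀ k : ℕ, ‖f (x + τ • w) - f x‖ ≤ L * (|τ| * ‖w‖) * |μ| ^ k := fun k => by
    rw [← (hiso k _ (hfP (x + τ • w) x)).2, hsub, ← hit, ← hit, horb]
    refine (hL _ _).trans (le_of_eq ?_)
    rw [add_sub_cancel_left, norm_smul, Real.norm_eq_abs, abs_mul, abs_pow]; ring
  have ht : Tendsto (fun k : ℕ => L * (|τ| * ‖w‖) * |μ| ^ k) atTop (𝓝 0) := by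
    simpa using (tendsto_pow_atTop_nhds_zero_of_lt_one (abs_nonneg _) hμ).const_mul (L * (|τ| * ‖w‖))
  have h0 : ‖f (x + τ • w) - f x‖ ≤ 0 := ge_of_tendsto' ht key
  exact sub_eq_zero.1 (norm_le_zero_iff.1 h0)

/-- The loxodromic linear part `M v = R v + (μ − 1)⟪e, v⟫ e` as a continuous linear map. -/
def loxL (R : E3 ≃ₗᵢ[ℝ] E3) (e : E3) (μ : ℝ) : E3 →L[ℝ] E3 :=
  (R.toContinuousLinearEquiv : E3 →L[ℝ] E3) + (μ - 1) • (innerSL ℝ e).smulRight e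

/-- Component / evaluation formula (`loxL_apply`). -/
@[simp] theorem loxL_apply (R : E3 ≃ₗᵢ[ℝ] E3) (e : E3) (μ : ℝ) (v : E3) :
    loxL R e μ v = R v + ((μ - 1) * ⟪e, v⟫) • e := by
  simp [loxL, smul_smul]

/-- Auxiliary lemma of the line, stated and proved verbatim (`inner_isometry_of_fixed`). -/
theorem inner_isometry_of_fixed {R : E3 ≃ₗᵢ[ℝ] E3} {e : E3} (hRe : R e = e) (v : E3) :
    ⟪e, R v⟫ = ⟪e, v⟫ := by
  conv_lhs => rw [← hRe]
  exact R.inner_map_map e v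

/-- `e` is a left and right eigenvector of the loxodromic part: `⟪e, M v⟫ = μ⟪e, v⟫`, `M e = μ e`. -/
theorem inner_loxL {R : E3 ≃ₗᵢ[ℝ] E3} {e : E3} (he : ‖e‖ = 1) (hRe : R e = e) (μ : ℝ) (v : E3) :
    ⟪e, loxL R e μ v⟫ = μ * ⟪e, v⟫ := by
  rw [loxL_apply, inner_add_right, real_inner_smul_right, inner_isometry_of_fixed hRe,
    real_inner_self_eq_norm_sq, he]
  ring

/-- Auxiliary lemma of the line, stated and proved verbatim (`loxL_self`). -/
theorem loxL_self {R : E3 ≃ₗᵢ[ℝ] E3} {e : E3} (he : ‖e‖ = 1) (hRe : R e = e) (μ : ℝ) :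
    loxL R e μ e = μ • e := by
  rw [loxL_apply, hRe, real_inner_self_eq_norm_sq, he]
  module

/-- On the invariant plane `e^⊥` the loxodromic part is the isometry `R`. -/
theorem loxL_of_orth {R : E3 ≃ₗᵢ[ℝ] E3} {e : E3} (hRe : R e = e) (μ : ℝ) {v : E3} (hv : ⟪e, v⟫ = 0) :
    ⟪e, loxL R e μ v⟫ = 0 ∧ ‖loxL R e μ v‖ = ‖v‖ := by
  have h1 : loxL R e μ v = R v := by rw [loxL_apply, hv, mul_zero, zero_smul, add_zero]
  rw [h1, inner_isometry_of_fixed hRe, hv, R.norm_map]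
  exact ⟨rfl, rfl⟩

/-- The inverse of the loxodromic part is loxodromic: `(R, e, μ)⁻¹ = (R⁻¹, e, μ⁻¹)`. -/
theorem loxL_inv {R : E3 ≃ₗᵢ[ℝ] E3} {e : E3} (he : ‖e‖ = 1) (hRe : R e = e) {μ : ℝ} (hμ : μ ≠ 0)
    (v : E3) : loxL R e μ (loxL R.symm e μ⁻¹ v) = v ∧ loxL R.symm e μ⁻¹ (loxL R e μ v) = v := by
  have hRe' : R.symm e = e := by
    rw [← hRe, LinearIsometryEquiv.symm_apply_apply]; exact hRe.symm
  have k1 := inner_loxL he hRe' μ⁻¹ v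
  have k2 := inner_loxL he hRe μ v
  constructor
  · rw [loxL_apply, k1, loxL_apply, map_add, map_smul, R.apply_symm_apply, hRe]
    match_scalars <;> (field_simp; try ring)
  · rw [loxL_apply, k2, loxL_apply, map_add, map_smul, R.symm_apply_apply, hRe']
    match_scalars <;> (field_simp; try ring)

/-- LAWS 1 + 2 assembled (loxodromic type): a bounded Lipschitz twin `f(Mx + b) = M f(x)`,
`M = loxL R e μ` (`‖e‖ = 1`, `R e = e`, `|μ| ≠ 1`, `μ ≠ 0`) is invariant under all translations along `e`. -/
theorem translate_eq_of_twin_loxodromic {f : E3 → E3} {R : E3 ≃ₗᵢ[ℝ] E3} {e b : E3} {μ K L : ℝ}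
    (he : ‖e‖ = 1) (hRe : R e = e) (h1 : |μ| ≠ 1) (h0 : μ ≠ 0) (hK : ∀ x, ‖f x‖ ≤ K)
    (hL : ∀ x y, ‖f x - f y‖ ≤ L * ‖x - y‖) (h : ∀ x, f (loxL R e μ x + b) = loxL R e μ (f x))
    (x : E3) (τ : ℝ) : f (x + τ • e) = f x := by
  have hRe' : R.symm e = e := by
    rw [← hRe, LinearIsometryEquiv.symm_apply_apply]; exact hRe.symm
  have hinv : ∀ y, f (loxL R.symm e μ⁻¹ y + -(loxL R.symm e μ⁻¹ b)) = loxL R.symm e μ⁻¹ (f y) :=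
    twin_inv_clm (fun v => (loxL_inv he hRe h0 v).1) (fun v => (loxL_inv he hRe h0 v).2) h
  -- heights die (LAW 1 on the expanding one of `M`, `M⁻¹`)
  have hz : ∀ x, ⟪e, f x⟫ = 0 := by
    rcases lt_or_gt_of_ne h1 with hlt | hgt
    · have hgt' : 1 < |μ⁻¹| := by rw [abs_inv]; exact one_lt_inv_iff₀.2 ⟨abs_pos.2 h0, hlt⟩
      exact covector_eq_zero_of_twin hK hinv (inner_loxL he hRe' μ⁻¹) hgt'
    · exact covector_eq_zero_of_twin hK h (inner_loxL he hRe μ) hgt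
  have hP : ∀ x y, ⟪e, f x - f y⟫ = 0 := fun x y => by rw [inner_sub_right, hz, hz, sub_zero]
  rcases lt_or_gt_of_ne h1 with hlt | hgt
  · exact translate_eq_of_twin_contracting (P := fun v => ⟪e, v⟫ = 0)
      (fun v hv => loxL_of_orth hRe μ hv) hP hL h (loxL_self he hRe μ) hlt x τ
  · have hlt' : |μ⁻¹| < 1 := by rw [abs_inv]; exact inv_lt_one_of_one_lt₀ hgt
    exact translate_eq_of_twin_contracting (P := fun v => ⟪e, v⟫ = 0)
      (fun v hv => loxL_of_orth hRe' μ⁻¹ hv) hP hL hinv (loxL_self he hRe' μ⁻¹) hlt' x τ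

/-! ### §C  Controls (hypotheses are load-bearing; the open cell is kinematically nonempty) -/

/-- Control 1 (the side condition `m ≠ 0` / `μ ≠ 1` is load-bearing): with `m = 0`, `b = 0` EVERY field is
its own twin — a row without it would be the rung (L′) itself. -/
theorem control_vacuous (f : E3 → E3) (n x : E3) : f (aff 0 n 0 x) = elem 0 n (f x) := by
  simp [aff, elem]

/-- Control 2 (boundedness is load-bearing in LAW 1): the unbounded linear field `f(x) = ⟪n, x⟫ m` is an
elementary twin for EVERY multiplier (with `b = 0`), and its height `⟪n, f x⟫ = ⟪n, m⟫ ⟪n, x⟫` is not zero. -/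
theorem control_unbounded_twin (m n x : E3) :
    (fun y : E3 => ⟪n, y⟫ • m) (aff m n 0 x) = elem m n ((fun y : E3 => ⟪n, y⟫ • m) x) := by
  simp only [aff, elem, add_zero, inner_add_right, real_inner_smul_right]
  module

/-- Control 3 (the FIXED POINT is load-bearing in LAW 3; the open cell `Row_A2afPd` is kinematically
nonempty): in coordinates `n = e₀`, `m = e₁`, drift `b = e₀ + ½ e₁` (`⟪n, b⟫ = 1 ≠ 0`: no fixed point), the
entire bounded field `F(x) = cos(x₁ − x₀²/2) e₂` is a TWIN of the fixed-point-free shear `g` (it is invariant,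
and `⟪n, F⟫ = 0`; it is also divergence-free, `F₂` not depending on `x₂`), yet it is NOT invariant under
translations along `m = e₁`. -/
def driftF (x : E3) : E3 := Real.cos (x 1 - x 0 ^ 2 / 2) • EuclideanSpace.single 2 1

/-- Control / verdict of the finite model (`control_parabolic_drift`). -/
theorem control_parabolic_drift :
    (∀ x : E3, driftF (aff (EuclideanSpace.single 1 1) (EuclideanSpace.single 0 1)
        (EuclideanSpace.single 0 1 + (1 / 2 : ℝ) • EuclideanSpace.single 1 1) x)
        = elem (EuclideanSpace.single 1 1) (EuclideanSpace.single 0 1) (driftF x)) ∧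
    (∀ x : E3, ⟪(EuclideanSpace.single 0 1 : E3), driftF x⟫ = 0) ∧ (∀ x : E3, ‖driftF x‖ ≤ 1) ∧
    driftF ((0 : E3) + Real.pi • EuclideanSpace.single 1 1) ≠ driftF 0 := by
  have h0 : ∀ x : E3, ⟪(EuclideanSpace.single 0 1 : E3), driftF x⟫ = 0 := fun x => by
    simp [driftF, EuclideanSpace.inner_single_left]
  refine ⟨fun x => ?_, h0, fun x => ?_, ?_⟩
  · rw [elem_of_inner_eq_zero (h0 x)]
    simp only [driftF, aff]
    congr 1
    simp [EuclideanSpace.inner_single_left]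
    ring_nf
  · rw [driftF, norm_smul, Real.norm_eq_abs]
    have h1 : ‖(EuclideanSpace.single 2 (1 : ℝ) : E3)‖ = 1 := by simp
    rw [h1, mul_one]
    exact Real.abs_cos_le_one _
  · simp only [driftF]
    intro h
    have h2 := congrArg (fun v : E3 => v 2) h
    simp at h2
    norm_num at h2

end Summit.NavierStokesRegularity.NavierStokesRegularity.Theorems.ScenarioCensus.AffineMeter

end
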